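import Mathlib.NumberTheory.Modular
import Literature.NumberTheory.EllipticCurves.SingularModuliConjugate
import Literature.NumberTheory.EllipticCurves.ComplexMultiplicationHasCMThreeLeavesProofs
import HarnessLib

/-!
# `finite_point_of_hasCM_of_L_one_ne_zero` from two leaves: the class-equation leaf discharged

Topic `NumberTheory/EllipticCurves` (complex multiplication; Coates–Wiles).  The three-leaf assembly
`finite_point_of_hasCM_of_L_one_ne_zero_of_three_leaves (h1 hirr hh)`
(`ComplexMultiplicationHasCMThreeLeavesProofs.lean`) used the named fact `irreducible_classPolynomial`
(`hirr`, Cox Prop. 13.2) only through `classNumber_eq_one_of_formJ_eq`: a rational singular modulus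
`j(τ_Q) ∈ ℚ` forces `h(D) = 1`.  Here that step is proved from the theorem
`singularModuli_conjugate_holds` (`SingularModuliConjugate.lean`): conjugacy makes `j` constant (`= q`)
on the reduced forms of discriminant `D`, and `j` separates reduced forms (`δ` below), so there is
only one.  Results:

* `smul_eq_self_of_inStrictFd` — two `SL(2, ℤ)`-equivalent points of the strict fundamental domain
  `{z ∈ 𝒟 : Re z < 1/2; Re z ≤ 0 if |z| = 1}` are equal (Serre, *Cours d'arithmétique* VII Thm. 1;
  read off Mathlib's classification `ModularGroup.cases_of_mem_fd_smul_mem_fd` and `stabilizer_ρ`);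
* `inStrictFd_heegnerTau` — Heegner points of reduced forms lie in it (Cox, proof of Thm. 11.2);
  `eq_of_heegnerTau_eq`; **`formJ_injOn_reducedForms`** (`δ`: Cox Thm. 11.2 with Thm. 2.8, "the
  `j(𝔞ᵢ)` are distinct");
* `classNumber_eq_one_of_formJ_eq_ratCast` — `j(τ_Q) = q ∈ ℚ ⟹ h(D) = 1 ∧ q = j(τ_P)`, no hypotheses;
* `mem_cmJInvariants_of_periodPair_hasCM_of_hh`, `j_mem_cmJInvariants_of_hasCM_of_one_fact (hh)`;
* **`finite_point_of_hasCM_of_L_one_ne_zero_of_two_leaves (h1 hh)`** and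
  `bsdRankFormula_of_hasCM_of_L_one_ne_zero_of_two_leaves (h1 hh)`: the target now rests on exactly
  `h1 = CoatesWiles1977_L_one_div_period_mem_prime` (the `𝔭`-divisibility core of Coates–Wiles, Thm. 1
  p. 223 via their §§3–6) and `hh = mem_classNumberOneDiscrs_of_classNumber_eq_one` (Heegner–Baker–Stark
  for orders, Cox Thm. 7.30(ii)).

## References

* J. Coates, A. Wiles, *On the conjecture of Birch and Swinnerton-Dyer*, Invent. Math. 39 (1977),
  Thm. 1 (p. 223). [CoatesWiles1977]
* J. H. Silverman, *The Arithmetic of Elliptic Curves*, 2nd ed. (2009), App. C §11 Examples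
  11.3.1–11.3.2, App. C §16 Evidence 16.5.3. [SilvermanAEC2009]
* D. A. Cox, *Primes of the form x² + ny²*, 2nd ed. (2013), §2.A Thm. 2.8, §11.A Thm. 11.2, §13.A
  Prop. 13.2, Thm. 7.30. [Cox2013]
* J.-P. Serre, *Cours d'arithmétique* (1970), Ch. VII §1.2 Thm. 1.
-/

noncomputable section

open Polynomial UpperHalfPlane ModularGroup
open scoped Modular MatrixGroups

namespace Literature.NumberTheory.EllipticCurves

open Literature.NumberTheory.QuadraticFields.BinaryQuadraticForm
  Literature.NumberTheory.QuadraticFields.Quadratic Literature.NumberTheory.EllipticCurves.ModularForms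

/-! ### The strict fundamental domain: `SL(2, ℤ)`-equivalent points are equal -/

/-- The **strict fundamental domain** `{z ∈ 𝒟 : Re z < 1/2, and Re z ≤ 0 if |z| = 1}` (Serre, *Cours
d'arithmétique*, VII.1.2; Cox §11.A before Thm. 11.2): a set of representatives of `SL(2, ℤ)\ℍ`.
[folklore] -/
def InStrictFd (z : ℍ) : Prop := z ∈ 𝒟 ∧ z.re < 1 / 2 ∧ (‖(z : ℂ)‖ = 1 → z.re ≤ 0)

/-- `Re ρ = −1/2`. [folklore] -/
lemma re_rho : (ρ : ℍ).re = -1 / 2 := rfl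

/-- `Re (1 + ρ) = 1/2`. [folklore] -/
lemma re_one_vadd_rho : ((1 : ℝ) +ᵥ (ρ : ℍ)).re = 1 / 2 := by
  rw [vadd_re, re_rho]; norm_num

/-- On the unit circle, `S • z = −1/z = −z̄`. [folklore] -/
lemma coe_S_smul_of_norm_eq_one {z : ℍ} (hz : ‖(z : ℂ)‖ = 1) : ((S • z : ℍ) : ℂ) = -(starRingEnd ℂ) (z : ℂ) := by
  rw [modular_S_smul, coe_mk]
  have hzz : (z : ℂ) * (starRingEnd ℂ) (z : ℂ) = 1 := by
    rw [Complex.mul_conj, Complex.normSq_eq_norm_sq, hz]; simp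
  have hz0 : (z : ℂ) ≠ 0 := z.ne_zero
  rw [inv_neg, show ((z : ℂ))⁻¹ = (starRingEnd ℂ) (z : ℂ) from (eq_inv_of_mul_eq_one_right hzz).symm]

/-- **Two points of the strict fundamental domain in the same `SL(2, ℤ)`-orbit are equal** (Serre VII,
Thm. 1 (2)–(3); from Mathlib's classification `ModularGroup.cases_of_mem_fd_smul_mem_fd`). [folklore] -/
theorem smul_eq_self_of_inStrictFd {g : SL(2, ℤ)} {z : ℍ} (hz : InStrictFd z) (hg : InStrictFd (g • z)) :
    g • z = z := by
  obtain ⟨hzD, hzre, hzS⟩ := hz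
  obtain ⟨hwD, hwre, hwS⟩ := hg
  have hST : (S * T) • ρ = ρ := stabilizer_ρ.mpr (by simp)
  have hTS : (T⁻¹ * S) • ρ = ρ := stabilizer_ρ.mpr (by simp)
  rcases cases_of_mem_fd_smul_mem_fd hzD hwD with h | ⟨h, hre⟩ | ⟨h, hre⟩ | ⟨h, hnorm⟩ | ⟨h, hz1⟩ |
      ⟨h, hz1⟩ | ⟨h, hz1⟩ | ⟨h, hzρ⟩ | ⟨h, hzρ⟩ | ⟨h, hzρ⟩
  · rcases h with rfl | rfl
    · exact one_smul _ _
    · rw [SL_neg_smul]; exact one_smul _ _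
  · exfalso
    have : (g • z).re = z.re + 1 := by
      rcases h with rfl | rfl
      · exact re_T_smul z
      · rw [SL_neg_smul]; exact re_T_smul z
    linarith
  · exfalso; linarith
  · -- `g = ±S`, `|z| = 1`: both `z` and `−z̄` have real part `≤ 0`
    have hw : g • z = S • z := by
      rcases h with rfl | rfl
      · rfl
      · exact SL_neg_smul S z
    rw [hw] at hwS ⊢
    have hcoe := coe_S_smul_of_norm_eq_one hnorm
    have hnormw : ‖((S • z : ℍ) : ℂ)‖ = 1 := by rw [hcoe, norm_neg, Complex.norm_conj, hnorm]
    have hrew : (S • z).re = -z.re := by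
      rw [← coe_re, hcoe]; simp
    have h1 := hzS hnorm
    have h2 := hwS hnormw
    rw [hrew] at h2
    have hre0 : z.re = 0 := le_antisymm h1 (by linarith)
    apply UpperHalfPlane.ext
    rw [hcoe]
    apply Complex.ext
    · simp [hre0]
    · simp
  · exfalso; rw [hz1, re_one_vadd_rho] at hzre; linarith
  · exfalso; rw [hz1, re_one_vadd_rho] at hzre; linarith
  · exfalso; rw [hz1, re_one_vadd_rho] at hzre; linarith
  · subst hzρ
    rcases h with rfl | rfl
    · exact hST
    · rw [SL_neg_smul]; exact hST
  · exfalso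
    subst hzρ
    have hw : g • ρ = T • ρ := by
      rcases h with rfl | rfl
      · rw [mul_assoc, mul_smul, hST]
      · rw [SL_neg_smul, mul_assoc, mul_smul, hST]
    have : (g • ρ).re = 1 / 2 := by rw [hw, re_T_smul, re_rho]; norm_num
    linarith
  · subst hzρ
    rcases h with rfl | rfl
    · exact hTS
    · rw [SL_neg_smul]; exact hTS

/-! ### Heegner points of reduced forms lie in the strict fundamental domain -/

section Forms

variable {Q : ℤ × ℤ × ℤ}

/-- Real and imaginary part, and `|τ_Q|² = c/a`, of the Heegner point of a positive definite form.
[folklore] -/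
lemma re_heegnerTau (hQ : 0 < Q.1) (hdisc : discr Q < 0) : (heegnerTau Q).re = -(Q.2.1 : ℝ) / (2 * Q.1) := by
  rw [← coe_re, coe_heegnerTau hQ hdisc]

/-- `Im τ_Q = √(4ac − b²)/(2a)`. [folklore] -/
lemma im_heegnerTau (hQ : 0 < Q.1) (hdisc : discr Q < 0) :
    (heegnerTau Q).im = √(4 * Q.1 * Q.2.2 - Q.2.1 ^ 2 : ℝ) / (2 * Q.1) := by
  rw [← coe_im, coe_heegnerTau hQ hdisc]

/-- `|τ_Q|² = c/a`. [folklore] -/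
lemma normSq_heegnerTau (hQ : 0 < Q.1) (hdisc : discr Q < 0) :
    Complex.normSq (heegnerTau Q : ℂ) = (Q.2.2 : ℝ) / Q.1 := by
  rw [coe_heegnerTau hQ hdisc, Complex.normSq_mk]
  have hA : (0 : ℝ) < Q.1 := by exact_mod_cast hQ
  have hD : (0 : ℝ) ≤ 4 * Q.1 * Q.2.2 - Q.2.1 ^ 2 := by
    have : discr Q ≤ 0 := hdisc.le
    rw [show discr Q = Q.2.1 ^ 2 - 4 * Q.1 * Q.2.2 from rfl] at this
    have h2 : ((Q.2.1 ^ 2 - 4 * Q.1 * Q.2.2 : ℤ) : ℝ) ≤ 0 := by exact_mod_cast this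
    push_cast at h2; linarith
  rw [div_mul_div_comm, div_mul_div_comm, Real.mul_self_sqrt hD, ← add_div]
  field_simp
  ring

/-- **The Heegner point of a reduced form lies in the strict fundamental domain** (Cox, proof of
Thm. 11.2 / Exercise 11.1: `|b| ≤ a ≤ c` gives `|Re τ| ≤ 1/2`, `|τ| ≥ 1`, and the tie-breaking conditions
`b ≥ 0` match `Re τ ≤ 0`). [cite: Cox2013, §2.A Thm. 2.8 and §11.A (proof of Thm. 11.2)] -/
theorem inStrictFd_heegnerTau {D : ℤ} (hD : D < 0) (hQ : Q ∈ reducedForms D) : InStrictFd (heegnerTau Q) := by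
  obtain ⟨hdisc, hQ1, -, hred⟩ := (mem_reducedForms_iff hD).1 hQ
  have hdisc' : discr Q < 0 := hdisc ▸ hD
  obtain ⟨h1, h2, h3, h4⟩ := hred
  have hA : (0 : ℝ) < Q.1 := by exact_mod_cast hQ1
  have hre := re_heegnerTau hQ1 hdisc'
  have hnsq := normSq_heegnerTau hQ1 hdisc'
  have hb1 : (-(Q.1 : ℝ)) ≤ Q.2.1 := by exact_mod_cast h1
  have hb2 : (Q.2.1 : ℝ) ≤ Q.1 := by exact_mod_cast h2
  have hc : (Q.1 : ℝ) ≤ Q.2.2 := by exact_mod_cast h3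
  refine ⟨⟨?_, ?_⟩, ?_, ?_⟩
  · rw [hnsq, le_div_iff₀ hA]; linarith
  · rw [hre, abs_le]
    constructor
    · rw [le_div_iff₀ (by linarith)]; linarith
    · rw [div_le_iff₀ (by linarith)]; linarith
  · -- `Re τ = 1/2` would mean `b = −a`, excluded by `b ≥ 0` when `|b| = a`
    rw [hre, div_lt_iff₀ (by linarith)]
    rcases lt_or_eq_of_le h1 with hlt | heq
    · have : (-(Q.1 : ℝ)) < Q.2.1 := by exact_mod_cast hlt
      linarith
    · have hb0 : 0 ≤ Q.2.1 := h4 (Or.inl heq.symm)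
      have : (0 : ℝ) ≤ Q.2.1 := by exact_mod_cast hb0
      linarith
  · -- `|τ| = 1` means `a = c`, and then `b ≥ 0`, i.e. `Re τ ≤ 0`
    intro hnorm
    have hac : Q.1 = Q.2.2 := by
      have h := hnsq
      rw [Complex.normSq_eq_norm_sq, hnorm, one_pow, eq_div_iff hA.ne', one_mul] at h
      exact_mod_cast h
    have hb0 : (0 : ℝ) ≤ Q.2.1 := by exact_mod_cast h4 (Or.inr (Or.inr hac))
    rw [hre, div_le_iff₀ (by linarith)]
    linarith

/-- **A positive definite form is determined by its discriminant and its Heegner point.** [folklore] -/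
theorem eq_of_heegnerTau_eq {Q Q' : ℤ × ℤ × ℤ} (hQ : 0 < Q.1) (hQ' : 0 < Q'.1) (hdisc : discr Q < 0)
    (hDD : discr Q' = discr Q) (h : heegnerTau Q' = heegnerTau Q) : Q' = Q := by
  have hdisc' : discr Q' < 0 := hDD ▸ hdisc
  have hA : (0 : ℝ) < Q.1 := by exact_mod_cast hQ
  have hA' : (0 : ℝ) < Q'.1 := by exact_mod_cast hQ'
  have him := congrArg UpperHalfPlane.im h
  rw [im_heegnerTau hQ hdisc, im_heegnerTau hQ' hdisc'] at him
  have hrad : (4 * (Q'.1 : ℝ) * Q'.2.2 - Q'.2.1 ^ 2 : ℝ) = 4 * Q.1 * Q.2.2 - Q.2.1 ^ 2 := by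
    have := congrArg (Int.cast : ℤ → ℝ) hDD
    rw [show discr Q' = Q'.2.1 ^ 2 - 4 * Q'.1 * Q'.2.2 from rfl,
      show discr Q = Q.2.1 ^ 2 - 4 * Q.1 * Q.2.2 from rfl] at this
    push_cast at this; linarith
  have hpos : (0 : ℝ) < √(4 * Q.1 * Q.2.2 - Q.2.1 ^ 2 : ℝ) := by
    apply Real.sqrt_pos.mpr
    have : ((Q.2.1 ^ 2 - 4 * Q.1 * Q.2.2 : ℤ) : ℝ) < 0 := by exact_mod_cast (show discr Q < 0 from hdisc)
    push_cast at this; linarith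
  rw [hrad] at him
  have ha : (Q'.1 : ℝ) = Q.1 := by
    field_simp at him
    nlinarith [him, hpos]
  have haZ : Q'.1 = Q.1 := by exact_mod_cast ha
  have hre := congrArg UpperHalfPlane.re h
  rw [re_heegnerTau hQ hdisc, re_heegnerTau hQ' hdisc', ha] at hre
  have hb : (Q'.2.1 : ℝ) = Q.2.1 := by
    field_simp at hre
    linarith
  have hbZ : Q'.2.1 = Q.2.1 := by exact_mod_cast hb
  have hc : Q'.2.2 = Q.2.2 := by
    have h1 := hDD
    rw [show discr Q' = Q'.2.1 ^ 2 - 4 * Q'.1 * Q'.2.2 from rfl,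
      show discr Q = Q.2.1 ^ 2 - 4 * Q.1 * Q.2.2 from rfl, haZ, hbZ] at h1
    have h4a : (4 * Q.1) * Q'.2.2 = (4 * Q.1) * Q.2.2 := by linarith
    exact mul_left_cancel₀ (by positivity) h4a
  exact Prod.ext haZ (Prod.ext hbZ hc)

/-- **`j` separates the reduced forms of a given discriminant** (`δ`): `j(τ_Q) = j(τ_{Q'})` forces
`τ_{Q'} = γτ_Q` (`kleinJ_eq_kleinJ_iff`), both points lie in the strict fundamental domain, so they are
equal, and a form is determined by its Heegner point (Cox Thm. 11.2 with Thm. 2.8: "the `j(𝔞)` are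
distinct"). [cite: Cox2013, §11.A Thm. 11.2 and §2.A Thm. 2.8] -/
theorem formJ_injOn_reducedForms {D : ℤ} (hD : D < 0) :
    Set.InjOn formJ (reducedForms D : Set (ℤ × ℤ × ℤ)) := by
  intro Q hQ Q' hQ' h
  rw [Finset.mem_coe] at hQ hQ'
  rw [formJ_eq_kleinJ, formJ_eq_kleinJ, kleinJ_eq_kleinJ_iff] at h
  obtain ⟨γ, hγ⟩ := h
  have hz := inStrictFd_heegnerTau hD hQ
  have hw := inStrictFd_heegnerTau hD hQ'
  rw [← hγ] at hw
  have heq : heegnerTau Q' = heegnerTau Q := by rw [← hγ]; exact smul_eq_self_of_inStrictFd hz hw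
  obtain ⟨hd, h1, -, -⟩ := (mem_reducedForms_iff hD).1 hQ
  obtain ⟨hd', h1', -, -⟩ := (mem_reducedForms_iff hD).1 hQ'
  exact (eq_of_heegnerTau_eq h1 h1' (hd ▸ hD) (hd'.trans hd.symm) heq).symm

/-! ### A rational singular modulus forces class number one — from conjugacy instead of `H_D` -/

/-- **`classNumber_eq_one_of_formJ_eq` with the class-equation leaf discharged**: if `j(τ_Q) = q ∈ ℚ`
for a primitive positive definite form `Q` of discriminant `D`, then `h(D) = 1` and `q = j(τ_P)` for the
principal form `P` — by `singularModuli_conjugate_holds` every reduced form `Q'` of discriminant `D` has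
`j(τ_{Q'}) = q` (apply it to `G = X − q`), and `j` separates reduced forms
(`formJ_injOn_reducedForms`). (Cox §13.A; Silverman *AEC* C.11.3.1–2.)
[cite: Cox2013, §13.A Prop. 13.2] [cite: SilvermanAEC2009, App. C §11, Example 11.3.2] -/
theorem classNumber_eq_one_of_formJ_eq_ratCast {Q : ℤ × ℤ × ℤ} (hQ1 : 0 < Q.1) (hprim : IsPrimitive Q)
    (hdisc : discr Q < 0) {q : ℚ} (hq : formJ Q = q) :
    classNumber (discr Q) = 1 ∧ (q : ℂ) = formJ (principalForm (discr Q)) := by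
  have h4 := discr_emod_four Q
  have hall : ∀ Q' ∈ reducedForms (discr Q), formJ Q' = q := by
    intro Q' hQ'
    obtain ⟨hd', h1', hprim', -⟩ := (mem_reducedForms_iff hdisc).1 hQ'
    have h := singularModuli_conjugate_holds Q Q' hQ1 hprim h1' hprim' hdisc hd' (X - C q)
      (by simp [hq])
    simpa [sub_eq_zero] using h
  have hP := principalForm_mem_reducedForms hdisc h4
  refine ⟨?_, (hall _ hP).symm⟩
  rw [classNumber, Finset.card_eq_one]
  refine ⟨principalForm (discr Q), Finset.eq_singleton_iff_unique_mem.mpr ⟨hP, fun Q' hQ' ↦ ?_⟩⟩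
  exact formJ_injOn_reducedForms hdisc (Finset.mem_coe.mpr hQ') (Finset.mem_coe.mpr hP)
    ((hall _ hQ').trans (hall _ hP).symm)

end Forms

/-! ### Re-assembly: the target from two leaves -/

/-- `mem_cmJInvariants_of_periodPair_hasCM` with the class-equation leaf discharged: a CM lattice with
rational `j`-invariant has one of the thirteen CM `j`-invariants, assuming only Heegner–Baker–Stark for
orders (`hh`) beyond the proved facts. [cite: SilvermanAEC2009, App. C §11, Example 11.3.1–11.3.2] -/
theorem mem_cmJInvariants_of_periodPair_hasCM_of_hh (hh : mem_classNumberOneDiscrs_of_classNumber_eq_one)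
    {L : PeriodPair} (hL : L.HasCM) {q : ℚ} (hq : L.j = q) : q ∈ WeierstrassCurve.cmJInvariants := by
  obtain ⟨Q, hQ1, hprim, hdisc, hj⟩ := exists_isPrimitive_j_eq_of_hasCM hL
  rw [hj, ← formJ_def] at hq
  obtain ⟨h1, hqP⟩ := classNumber_eq_one_of_formJ_eq_ratCast hQ1 hprim hdisc hq
  have hD4 := discr_emod_four Q
  have hD := hh (discr Q) hdisc hD4 h1
  rw [formJ_principalForm hdisc hD4, j_cmPeriodPair_eq_singularModulus singularModuli_classNumberOne_holds
    singularModuli_nonmaximalOrders_holds hD] at hqP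
  rw [show q = singularModulus (discr Q) by exact_mod_cast hqP]
  exact singularModulus_mem_cmJInvariants hD

/-- **`j_mem_cmJInvariants_of_hasCM` from one named fact**: an elliptic curve over `ℚ` with (geometric)
complex multiplication has one of the thirteen rational CM `j`-invariants (Silverman *AEC* C.11.3.1–2),
assuming only Heegner–Baker–Stark for orders (`mem_classNumberOneDiscrs_of_classNumber_eq_one`, Cox
Thm. 7.30(ii)). [cite: SilvermanAEC2009, App. C §11, Example 11.3.1–11.3.2] -/
theorem j_mem_cmJInvariants_of_hasCM_of_one_fact (hh : mem_classNumberOneDiscrs_of_classNumber_eq_one) :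
    j_mem_cmJInvariants_of_hasCM := by
  intro W _ hCM
  haveI : (W.baseChange ℂ).IsElliptic := by rw [WeierstrassCurve.baseChange]; infer_instance
  obtain ⟨L, hL⟩ := exists_isNeronLatticeOf_holds (W.baseChange ℂ)
  have hjV : (W.baseChange ℂ).j = (W.j : ℂ) := by
    simp only [WeierstrassCurve.baseChange, WeierstrassCurve.map_j, eq_ratCast]
  have hj : L.j = (W.j : ℂ) := (PeriodPair.j_eq_weierstrassCurve_j hL.1 hL.2).trans hjV
  exact mem_cmJInvariants_of_periodPair_hasCM_of_hh hh (periodPair_hasCM_of_hasCM_holds W L hL hCM) hj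

/-- **`finite_point_of_hasCM_of_L_one_ne_zero` from its two remaining leaves.**  For an elliptic curve
`E/ℚ` with (geometric) complex multiplication and `L(E, 1) ≠ 0`, the group `E(ℚ)` is finite
(Coates–Wiles 1977, Thm. 1; Silverman *AEC* C.16.5.3) — assuming exactly the `𝔭`-divisibility core of
Coates–Wiles (`h1`) and Heegner–Baker–Stark for orders (`hh`); the class-equation leaf
`irreducible_classPolynomial` of the three-leaf assembly is replaced by the theorem
`singularModuli_conjugate_holds`. [cite: CoatesWiles1977, Thm 1 (p. 223)]
[cite: SilvermanAEC2009, App. C §16, Evidence C.16.5.3] -/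
theorem finite_point_of_hasCM_of_L_one_ne_zero_of_two_leaves
    (h1 : CoatesWiles1977_L_one_div_period_mem_prime)
    (hh : mem_classNumberOneDiscrs_of_classNumber_eq_one) :
    finite_point_of_hasCM_of_L_one_ne_zero :=
  finite_point_of_hasCM_of_L_one_ne_zero_of_CoatesWiles1977_of_j_mem_cmJInvariants_of_hasCM
    (CoatesWiles1977_L_one_eq_zero_of_not_isOfFinAddOrder_of_mem_prime_of_singularModuli h1
      singularModuli_classNumberOne_holds)
    (j_mem_cmJInvariants_of_hasCM_of_one_fact hh)

/-- The BSD rank formula `r_an(E) = rank E(ℚ)` (`= 0`) in the CM analytic-rank-zero case from the same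
two leaves. [cite: CoatesWiles1977, Thm 1 (rank-zero consequence)] -/
theorem bsdRankFormula_of_hasCM_of_L_one_ne_zero_of_two_leaves
    (h1 : CoatesWiles1977_L_one_div_period_mem_prime)
    (hh : mem_classNumberOneDiscrs_of_classNumber_eq_one) :
    bsdRankFormula_of_hasCM_of_L_one_ne_zero :=
  bsdRankFormula_of_hasCM_of_L_one_ne_zero_of_finite_point
    (finite_point_of_hasCM_of_L_one_ne_zero_of_two_leaves h1 hh)

end Literature.NumberTheory.EllipticCurves

end
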